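import Summits.HubbardSuperconductivity.HubbardSuperconductivity.Theorems.DWavePolarisedDiscordance.Negative.StaggeredTowerOrders

/-!
# Crux `DWavePolarisedDiscordance` (K3′, stmt-HubbardSuperconductivity-15314, route `LiebTwin`) —
# negative-side support: the BOTTOM-OF-SPECTRUM clause is load-bearing; the `η_π`-tower is the
# extremal discordant state

The crux `Theses.LiebTwin.DWavePolarisedDiscordance` (K3′) says: for every `(U, δ) ∈ (0,4]×[1/10,3/10]` there is
`κ > 0` such that for every `ε > 0`, eventually in even `L`, EVERY normalised `(N_L, S^z = 0)`-sector ground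
state `φ` of `hubbardTorus 2 L 1 U` satisfies `κ·(F_s(φ̃) - F_s(φ)) - εL⁴ ≤ F_d(φ) - F_d(φ̃)`, where
`F_g(χ) = Re⟨χ, (pairField g L)ᴴ (pairField g L) χ⟩` and `φ̃ = liebVec n (CFC.abs (liebW n φ))` is the twin
(`n = N_L/2 = ⌊(1-δ)L²/2⌋`).

This file does NOT refute the crux. It records two kernel-checked facts for provers and planners.

1. `dWavePolarisedDiscordance_false_without_minimality` — keep every clause of the crux (box, `κ/ε/L₀`
   quantifiers, even `L`, normalisation, membership in the joint sector, `φ ≠ 0`, the EIGENVECTOR equation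
   `H φ = E φ`) and drop ONLY the requirement that `E` be the lowest energy of the sector
   (`IsGroundStateInSector` ↦ "nonzero sector eigenvector"): the statement becomes FALSE. So K3′ is carried
   entirely by the variational (bottom-of-spectrum) property of `φ`; no argument from the eigenvalue equation,
   the sector bookkeeping, reality / flip-definiteness of the Lieb matrix, or symmetry can prove it.
2. `staggeredTower_rectification_orders` — the witness and extremiser: the normalised STAGGERED `η`-tower
   `φ_L ∝ (η_π†)^n |0⟩` (`etaPairingState torusStagger n`, Yang's exact eigenstate, energy `nU`) has Lieb matrix
   `W = n!·diag(±1)` (real, symmetric = flip-definite), hence `|W| = n!·1` and twin = the UNSTAGGERED doublon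
   condensate; `F_s(φ̃) = 2n(L² - n + 1)` is Yang's MAXIMUM while `F_s(φ) = 2(n - L²Y) ≤ 2n`
   (`Y = n(L²-n)/(L²(L²-1))`), so the discordance mass `m = F_s(φ̃) - F_s(φ) ≥ 2n(L² - n)` is macroscopic and
   maximal; and for EVERY bond form factor `g` with `g 0 = 0` (d-wave, extended-s) `F_g(φ) = F_g(φ̃)` EXACTLY —
   the d-wave rectification gain of the most discordant eigenstate is identically zero. In the card's language:
   the discordance map of `φ_L` has maximal mass and zero `ĝ_d ⊗ ĝ_d` moment; a proof of K3′ must show that a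
   GROUND state cannot carry a macroscopic `(π,π)`-pair (η) component of this kind — quantitatively, with the
   d-moment controlling the mass.

Ingredients (all tree): Yang's tower in closed form (`etaRaise_pow_mulVec_vacuum`), its pair amplitudes
(`pairAmplitude_etaPairingState`, `pairAnnihilation_mulVec_sum_pairs_succ`, `star_sum_pairs_dotProduct`),
`(pairField sWave L)ᴴ(pairField sWave L) = 2η₁†η₁` (`etaTower_pairField_conjTranspose_mul_self`), the twin
pair-order identity (`LiebTwinTwin.re_expect_pairField_sWave_twin_eq`), Yang's eigenvalue equation
(`hubbardTorus_mulVec_etaPairingState_holds`), the sublattice balance of the even torus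
(`LiebTwoHoppings.two_mul_card_filter_torusStagger_eq_one`), and `CFC.abs a = CFC.sqrt (a⋆a)`,
`CFC.sqrt (b b) = b` (`b ⪰ 0`). New here: the DISJOINT-SUPPORT lemma for bond pair fields on doublon sums
(`pairField_mulVec_single_pairSet_apply`, `expect_pairField_doublonSum_eq_of_norm_eq`).

Sources: C. N. Yang, PRL **63** (1989) 2144, eqs. (4)–(11); C. N. Yang, S. C. Zhang, Mod. Phys. Lett. B **4**
(1990) 759, §4; E. H. Lieb, PRL **62** (1989) 1201, proof of Thm 1; D. J. Scalapino, Phys. Rep. **250** (1995)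
329, §2. Elementary; no definition is introduced (the mutated proposition is spelled inline).
-/

noncomputable section

-- the mandated namespace repeats `HubbardSuperconductivity` (single-problem summit, D-0017)
set_option linter.dupNamespace false

namespace Summit.HubbardSuperconductivity.HubbardSuperconductivity.Theorems.DWavePolarisedDiscordance.Negative

open Matrix Finset Literature.MathematicalPhysics.QuantumLattice Literature.Probability.LatticeModels
open Summit.HubbardSuperconductivity.HubbardSuperconductivity.Theorems.NoOnsiteODLRO.Negative
  (isInSector_etaPairingState)
open Summit.HubbardSuperconductivity.HubbardSuperconductivity.Theorems.TwSeededEnsembleEquivalence.ExposedDensity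
  (etaTower_pairField_conjTranspose_mul_self)
open scoped ComplexOrder

/-! ### The mutation: drop ONLY the bottom-of-spectrum clause of `IsGroundStateInSector` -/

section Main

/-- The mutation below is a WEAKENING of the crux hypothesis: a sector ground state is in particular a
nonzero sector eigenvector. (So `DWavePolarisedDiscordance` is the negated statement of
`dWavePolarisedDiscordance_false_without_minimality` restricted to the eigenvalue `minEnergyOn`.) [folklore] -/
theorem eigen_of_isGroundStateInSector {Λ : Type*} [LinearOrder Λ] [Fintype Λ]
    {H : Matrix (Finset (Orb Λ)) (Finset (Orb Λ)) ℂ} {N : ℕ} {M : ℝ} {φ : Fock (Orb Λ)}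
    (h : IsGroundStateInSector H N M φ) :
    φ ∈ szSector N M ∧ φ ≠ 0 ∧ ∃ E : ℝ, H *ᵥ φ = (E : ℂ) • φ :=
  ⟨h.1, h.2.1, _, h.2.2⟩

open scoped MatrixOrder Matrix.Norms.L2Operator in
/-- **The extremal discordant eigenstate, summarised.** On the even torus of side `L ≥ 2`, for `1 ≤ n ≤ L²`
and any normalisation `c` of the staggered tower `φ = c (η_π†)^n|0⟩`: `φ` is an `(n,n)`-sector eigenvector of
`hubbardTorus 2 L t U` with energy `nU`; its twin has on-site pair order `F_s(φ̃) = 2n(L² - n + 1)‖φ‖²`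
(Yang's maximum); `F_s(φ) ≤ 2n` when `‖φ‖ = 1`; and for every bond form factor `g` with `g 0 = 0` the pair
orders of `φ` and `φ̃` coincide. Yang, PRL 63 (1989) 2144; Lieb, PRL 62 (1989) 1201. [folklore] -/
theorem staggeredTower_rectification_orders (L : ℕ) [NeZero L] [Fact (1 < L)] (hL : Even L) (t U : ℝ)
    {n : ℕ} (hn1 : 1 ≤ n) (hnL : n ≤ L ^ 2) (c : ℂ)
    (hc : star (c • etaPairingState (torusStagger (d := 2) (L := L)) n) ⬝ᵥ
      (c • etaPairingState torusStagger n) = 1) :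
    IsInSector n n (c • etaPairingState (torusStagger (d := 2) (L := L)) n) ∧
    hubbardTorus 2 L t U *ᵥ (c • etaPairingState (torusStagger (d := 2) (L := L)) n) =
      (((n : ℝ) * U : ℝ) : ℂ) • (c • etaPairingState torusStagger n) ∧
    (expect ((pairField sWave L)ᴴ * pairField sWave L)
        (liebVec n (CFC.abs (liebW n (c • etaPairingState (torusStagger (d := 2) (L := L)) n))))).re =
      2 * ((n : ℝ) * ((L : ℝ) ^ 2 - n + 1)) ∧
    (expect ((pairField sWave L)ᴴ * pairField sWave L)
        (c • etaPairingState (torusStagger (d := 2) (L := L)) n)).re ≤ 2 * (n : ℝ) ∧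
    (∀ g : Site 2 → ℝ, g 0 = 0 →
      expect ((pairField g L)ᴴ * pairField g L)
          (liebVec n (CFC.abs (liebW n (c • etaPairingState (torusStagger (d := 2) (L := L)) n)))) =
        expect ((pairField g L)ᴴ * pairField g L) (c • etaPairingState torusStagger n)) := by
  obtain ⟨k, rfl⟩ := Nat.exists_eq_add_one_of_ne_zero (Nat.one_le_iff_ne_zero.1 hn1)
  refine ⟨(isInSector_etaPairingState _ _).smul c, ?_, ?_, ?_, fun g hg =>
    expect_pairField_twin_smul_etaPairingState_eq hg _ _ c⟩
  · rw [mulVec_smul, hubbardTorus_mulVec_etaPairingState_holds hL t U (k + 1), smul_comm]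
  · rw [re_expect_pairField_sWave_twin_smul_etaPairingState, hc, Complex.one_re, mul_one]
  · exact_mod_cast re_expect_pairField_sWave_smul_staggeredTower_le hL k hnL hc

/-- Floor bookkeeping for the witness: with `X = L² ≥ 4` and `n = ⌊(3/4)X/2⌋`,
`3X/8 - 1 ≤ n ≤ 3X/8`; then `2n(X - n) - X²/8 > 0` and `1 ≤ n ≤ X`. [folklore] -/
theorem witness_arith {X n : ℝ} (hX : 4 ≤ X) (h1 : 3 * X / 8 - 1 ≤ n) (h2 : n ≤ 3 * X / 8) :
    X ^ 2 / 8 < 2 * (n * (X - n)) := by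
  nlinarith [mul_nonneg (sub_nonneg.2 h1) (sub_nonneg.2 h2), mul_nonneg (sub_nonneg.2 hX) (sub_nonneg.2 h2),
    mul_nonneg (sub_nonneg.2 hX) (sub_nonneg.2 h1)]

open scoped MatrixOrder Matrix.Norms.L2Operator in
/-- **The bottom-of-spectrum clause of K3′ (`DWavePolarisedDiscordance`) is load-bearing.** The negated
statement below is the crux `Theses.LiebTwin.DWavePolarisedDiscordance` VERBATIM except that
`IsGroundStateInSector H (2n) 0 φ` (`= φ ∈ szSector (2n) 0 ∧ φ ≠ 0 ∧ H φ = (minEnergyOn …) • φ`) is replaced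
by `φ ∈ szSector (2n) 0 ∧ φ ≠ 0 ∧ ∃ E, H φ = E • φ`: φ is still a normalised EXACT EIGENVECTOR of
`hubbardTorus 2 L 1 U` in the admissible sector — only the requirement that its eigenvalue be the LOWEST in the
sector is dropped. With that clause gone the statement is FALSE at every box point; we refute it at
`(U, δ) = (1, 1/4)`. Witness: the normalised STAGGERED `η`-tower `φ_L ∝ (η_π†)^n|0⟩`
(`etaPairingState torusStagger n`, `n = ⌊(3/4)L²/2⌋`), Yang's exact eigenstate of energy `nU`
(`hubbardTorus_mulVec_etaPairingState_holds`). Its Lieb matrix is `W = n! diag(±1)`, so the rectified matrix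
is `|W| = n!·1` (`cfcAbs_liebW_smul_etaPairingState`) and the twin is the UNSTAGGERED doublon condensate:
`F_s(φ̃) = 2n(L² - n + 1)` (Yang's maximum, `re_expect_pairField_sWave_twin_smul_etaPairingState`) while
`F_s(φ) = 2(n - L²Y) ≤ 2n` (`re_expect_pairField_sWave_smul_staggeredTower_le`), i.e. the discordance mass
`m = F_s(φ̃) - F_s(φ) ≥ 2n(L² - n) ≍ (15/32)L⁴` is MAXIMAL; but the d-wave rectification gain VANISHES
IDENTICALLY, `F_d(φ) = F_d(φ̃)` (`expect_pairField_twin_smul_etaPairingState_eq`: on doublon sums a bond pair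
field sees only the moduli of the weights). Hence `κ m - εL⁴ ≤ F_d(φ) - F_d(φ̃) = 0` fails for `ε = κ/8` at
every even `L ≥ 2`. READING FOR PROVERS: the eigenvector equation, the sector quantum numbers, reality,
flip-definiteness (`W` is real diagonal), translation and `SU(2)` covariance are all satisfied by the witness —
K3′ can only hold because a GROUND state cannot afford the staggered tower's sign structure (energy `nU` above
the doublon-free competition); any proof must be variational/spectral, and the `η_π`-tower is the extremal
discordant state (maximal mass, zero d-moment) that such an argument has to exclude quantitatively.
Yang, PRL 63 (1989) 2144, eqs. (4)–(11); Lieb, PRL 62 (1989) 1201; Scalapino, Phys. Rep. 250 (1995) 329, §2. [folklore] -/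
theorem dWavePolarisedDiscordance_false_without_minimality :
    ¬ (∀ U ∈ Set.Ioc (0 : ℝ) 4, ∀ δ ∈ Set.Icc (1 / 10 : ℝ) (3 / 10), ∃ κ : ℝ, 0 < κ ∧ ∀ ε : ℝ, 0 < ε →
        ∃ L₀ : ℕ, ∀ (L : ℕ) [NeZero L], L₀ ≤ L → Even L → ∀ φ : Fock (Orb (FermionTorus 2 L)),
          star φ ⬝ᵥ φ = 1 →
          (φ ∈ szSector (Λ := FermionTorus 2 L) (2 * ⌊(1 - δ) * (L : ℝ) ^ 2 / 2⌋₊) 0 ∧ φ ≠ 0 ∧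
              ∃ E : ℝ, hubbardTorus 2 L 1 U *ᵥ φ = (E : ℂ) • φ) →
          κ * ((expect ((pairField sWave L)ᴴ * pairField sWave L)
                  (liebVec ⌊(1 - δ) * (L : ℝ) ^ 2 / 2⌋₊
                    (CFC.abs (liebW ⌊(1 - δ) * (L : ℝ) ^ 2 / 2⌋₊ φ)))).re -
                (expect ((pairField sWave L)ᴴ * pairField sWave L) φ).re) - ε * (L : ℝ) ^ 4 ≤
            (expect ((pairField dWaveFormFactor L)ᴴ * pairField dWaveFormFactor L) φ).re -
              (expect ((pairField dWaveFormFactor L)ᴴ * pairField dWaveFormFactor L)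
                (liebVec ⌊(1 - δ) * (L : ℝ) ^ 2 / 2⌋₊
                  (CFC.abs (liebW ⌊(1 - δ) * (L : ℝ) ^ 2 / 2⌋₊ φ)))).re) := by
  intro h
  obtain ⟨κ, hκ, h⟩ := h 1 ⟨one_pos, by norm_num⟩ (1 / 4) ⟨by norm_num, by norm_num⟩
  obtain ⟨L₀, h⟩ := h (κ / 8) (by positivity)
  -- the even side `L = 2 (L₀ + 1) ≥ 2`
  haveI hNZ : NeZero (2 * (L₀ + 1)) := ⟨by omega⟩
  haveI hF : Fact (1 < 2 * (L₀ + 1)) := ⟨by omega⟩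
  have hLe : Even (2 * (L₀ + 1)) := even_two_mul _
  have h := h (2 * (L₀ + 1)) (by omega) hLe
  set L : ℕ := 2 * (L₀ + 1) with hLdef
  set n : ℕ := ⌊(1 - (1 / 4 : ℝ)) * (L : ℝ) ^ 2 / 2⌋₊ with hndef
  -- bookkeeping on `n`
  set X : ℝ := (L : ℝ) ^ 2 with hX
  have hX4 : 4 ≤ X := by
    have h2 : (2 : ℝ) ≤ (L : ℝ) := by exact_mod_cast (show 2 ≤ L by omega)
    rw [hX]
    nlinarith
  have hx : (1 - (1 / 4 : ℝ)) * (L : ℝ) ^ 2 / 2 = 3 * X / 8 := by rw [hX]; ring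
  have hn1 : 3 * X / 8 - 1 ≤ (n : ℝ) := by
    have hlt : (1 - (1 / 4 : ℝ)) * (L : ℝ) ^ 2 / 2 < (n : ℝ) + 1 := Nat.lt_floor_add_one _
    linarith
  have hn2 : (n : ℝ) ≤ 3 * X / 8 := by
    have hle : (n : ℝ) ≤ (1 - (1 / 4 : ℝ)) * (L : ℝ) ^ 2 / 2 := Nat.floor_le (by positivity)
    linarith
  have hnL : n ≤ L ^ 2 := by
    have : (n : ℝ) ≤ ((L ^ 2 : ℕ) : ℝ) := by push_cast; rw [← hX]; linarith
    exact_mod_cast this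
  have hn0 : n ≠ 0 := by
    intro h0
    rw [h0, Nat.cast_zero] at hn1
    linarith
  obtain ⟨k, hk⟩ := Nat.exists_eq_add_one_of_ne_zero hn0
  -- the witness: the normalised staggered tower
  set ψ : Fock (Orb (FermionTorus 2 L)) := etaPairingState (torusStagger (d := 2) (L := L)) n with hψ
  have hψ0 : ψ ≠ 0 := etaPairingState_ne_zero _ (by rwa [card_fermionTorus])
  obtain ⟨c, hc0, hc1⟩ := exists_smul_unit hψ0
  have hsec : IsInSector n n (c • ψ) := (isInSector_etaPairingState _ n).smul c
  have hmem : c • ψ ∈ szSector (Λ := FermionTorus 2 L) (2 * n) 0 :=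
    (mem_szSector_two_mul_zero_iff n _).2 hsec
  have hne : c • ψ ≠ 0 := smul_ne_zero hc0 hψ0
  have heig : hubbardTorus 2 L 1 1 *ᵥ (c • ψ) = (((n : ℝ) * 1 : ℝ) : ℂ) • (c • ψ) := by
    rw [mulVec_smul, hψ, hubbardTorus_mulVec_etaPairingState_holds hLe 1 1 n, smul_comm]
  have hbad := h (c • ψ) hc1 ⟨hmem, hne, _, heig⟩
  -- the four pair orders of the witness
  have hFt : (expect ((pairField sWave L)ᴴ * pairField sWave L)
      (liebVec n (CFC.abs (liebW n (c • ψ))))).re = 2 * ((n : ℝ) * (X - n + 1)) := by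
    rw [hψ, re_expect_pairField_sWave_twin_smul_etaPairingState, hc1, Complex.one_re, mul_one]
  have hFp : (expect ((pairField sWave L)ᴴ * pairField sWave L) (c • ψ)).re ≤ 2 * (n : ℝ) := by
    have h' := re_expect_pairField_sWave_smul_staggeredTower_le (c := c) hLe k (hk ▸ hnL) (by rw [← hk]; exact hc1)
    rw [← hk] at h'
    exact_mod_cast h'
  have hFd : (expect ((pairField dWaveFormFactor L)ᴴ * pairField dWaveFormFactor L) (c • ψ)).re -
      (expect ((pairField dWaveFormFactor L)ᴴ * pairField dWaveFormFactor L)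
        (liebVec n (CFC.abs (liebW n (c • ψ))))).re = 0 := by
    rw [hψ, expect_pairField_twin_smul_etaPairingState_eq dWaveFormFactor_zero, sub_self]
  -- contradiction
  rw [hFt] at hbad
  have hL4 : (L : ℝ) ^ 4 = X ^ 2 := by rw [hX]; ring
  rw [hL4] at hbad
  have key := witness_arith hX4 hn1 hn2
  nlinarith [hbad, hFp, hFd, key, hκ, mul_pos hκ (sub_pos.2 key)]

end Main

end Summit.HubbardSuperconductivity.HubbardSuperconductivity.Theorems.DWavePolarisedDiscordance.Negative

end
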